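import Summits.QuantumFields.YangMills.Theorems.LuscherReductionTwistedTraceScalingInnerModelBlocks
import Summits.QuantumFields.YangMills.Theorems.LuscherReductionTwistedTraceScalingInnerKernelComparison
import HarnessLib

/-!
# C4 INNER, brick O (part 4): the three blocks for a kernel POINTWISE CLOSE to the model — `|K_true − k⊗K| ≤ η·(k⊗K)`
# (lane A of S-BASE, crux `TwistedTraceScaling` stmt-QuantumFields-20203; sub-target C4, design note `pub/ym-fleet/ym-luscher-20007-p1/COARSE-DESIGN.md` §21.3/§21.8)

In the product chart the lattice kernel (times Jacobians) is NOT the tensor model `k(c,c')·K(q,q')` but is pointwise within a factor `1 ± η` of it on the bulk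
(`η = O(β^{−1/4}·polylog)`, §21.1 (N2)).  Combining the exact model blocks (`…InnerModelBlocks`) with the signed/bilinear comparison lemmas
(`…InnerKernelComparison`) gives the STIFF and OFF-DIAGONAL clauses of `InnerBOPackageAt` and the two-sided DIAGONAL comparison, for ANY kernel `K₂` on
`X = C × ℝ^σ` with `|K₂(x,x') − k(c,c')K(q,q')| ≤ η·k(c,c')K(q,q')`:
* ★★ `true_boOrth_le`     — STIFF:   `T₂(Φ−PΦ, Φ−PΦ) ≤ (λ₀ρ + ηM)·μ₁·‖Φ−PΦ‖²` (`M = Π√(π/a_k)` the crude Mehler row bound);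
* ★★ `true_boProj_boOrth` — OFF-DIAG: `|T₂(PΦ, Ψ−PΨ)| ≤ η·μ₁M·‖PΦ‖·‖Ψ−PΨ‖`;
* ★★ `true_boProj_boProj` — DIAG:    `|T₂(PΦ, PΦ) − λ₀ ∫∫ φ₀ k φ₀| ≤ η·μ₁M·‖PΦ‖²`.
HONEST FRAMING: measure-theoretic bookkeeping for a stub of a child of the CONDITIONAL reduction route (femto rung R2b1); the chart supplying `K₂`, `k`, `η` is OPEN; not infinite
volume, not a gap, not Clay.

## References
* B. Helffer, *Spectral Theory and its Applications*, CUP 2013, Lemma 7.1 (Schur's test). [Helffer2013]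
* M. Lüscher, Nucl. Phys. B219 (1983) 233, §3. [Luscher1983]
-/

set_option autoImplicit false

open MeasureTheory Filter Topology
open scoped Real

namespace Summit.QuantumFields.YangMills.Theorems.FemtoTransferGap.Mehler

open Literature.Analysis.SegalBargmann Literature.Analysis.OperatorTheory KernelComparison

noncomputable section

variable {C : Type*} [MeasurableSpace C] {ν : Measure C} [SFinite ν]
variable {σ : Type*} [Fintype σ] [DecidableEq σ]
variable {k : C → C → ℝ} {a b : σ → ℝ} {μ₁ ρ η : ℝ} {K₂ : (C × (σ → ℝ)) → (C × (σ → ℝ)) → ℝ}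

omit [SFinite ν] [DecidableEq σ] in
/-- The tensor form written as the double integral the comparison lemmas use. [folklore] -/
theorem tensorForm_eq (ν : Measure C) (k : C → C → ℝ) (a b : σ → ℝ) (u w : C × (σ → ℝ) → ℝ) :
    tensorForm ν k a b u w = ∫ x, ∫ x', u x * tensorKernel k a b x x' * w x' ∂(ν.prod volume) ∂(ν.prod volume) := rfl

omit [DecidableEq σ] in
/-- The hypotheses of the comparison lemmas for the tensor kernel and `L²` functions. [folklore] -/
theorem tensor_comparison_data (ha : ∀ i, 0 < a i) (hb : ∀ i, 0 < b i) (hk0 : ∀ c c', 0 ≤ k c c') (hksymm : ∀ c c', k c c' = k c' c)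
    (hkm : Measurable (Function.uncurry k)) (hkint : ∀ c, Integrable (k c) ν) (hkrow : ∀ c, ∫ c', k c c' ∂ν ≤ μ₁)
    (hK₂m : Measurable (Function.uncurry K₂)) {u w : C × (σ → ℝ) → ℝ} (hu : MemLp u 2 (ν.prod volume)) (hw : MemLp w 2 (ν.prod volume)) :
    (∀ x x', 0 ≤ tensorKernel k a b x x') ∧ (∀ x x', tensorKernel k a b x x' = tensorKernel k a b x' x) ∧
    (∀ᵐ x ∂(ν.prod volume), ∫ x', tensorKernel k a b x x' ∂(ν.prod volume) ≤ μ₁ * ∏ i, Real.sqrt (π / a i)) ∧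
    Integrable (fun x => u x ^ 2) (ν.prod volume) ∧ Integrable (fun x => w x ^ 2) (ν.prod volume) ∧
    AEStronglyMeasurable (fun p : (C × (σ → ℝ)) × (C × (σ → ℝ)) => u p.1 * K₂ p.1 p.2 * w p.2) ((ν.prod volume).prod (ν.prod volume)) ∧
    Integrable (fun p : (C × (σ → ℝ)) × (C × (σ → ℝ)) => |u p.1| * tensorKernel k a b p.1 p.2 * |w p.2|) ((ν.prod volume).prod (ν.prod volume)) ∧
    Integrable (fun p : (C × (σ → ℝ)) × (C × (σ → ℝ)) => u p.1 * tensorKernel k a b p.1 p.2 * w p.2) ((ν.prod volume).prod (ν.prod volume)) ∧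
    Integrable (fun p : (C × (σ → ℝ)) × (C × (σ → ℝ)) => tensorKernel k a b p.1 p.2 * u p.1 ^ 2) ((ν.prod volume).prod (ν.prod volume)) ∧
    Integrable (fun p : (C × (σ → ℝ)) × (C × (σ → ℝ)) => tensorKernel k a b p.1 p.2 * w p.2 ^ 2) ((ν.prod volume).prod (ν.prod volume)) := by
  have hb' : ∀ i, 0 ≤ b i := fun i => (hb i).le
  have huabs : MemLp (fun x => |u x|) 2 (ν.prod volume) := hu.abs
  have hwabs : MemLp (fun x => |w x|) 2 (ν.prod volume) := hw.abs
  refine ⟨fun x x' => tensorKernel_nonneg hk0 a b x x', fun x x' => tensorKernel_comm hksymm a b x x',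
    ae_of_all _ fun x => integral_tensorKernel_right_le ha hb' hk0 hkrow x, hu.integrable_sq, hw.integrable_sq, ?_,
    integrable_tensorForm_integrand ha hb' hk0 hksymm hkm hkint hkrow huabs hwabs,
    integrable_tensorForm_integrand ha hb' hk0 hksymm hkm hkint hkrow hu hw,
    integrable_tensorKernel_mul_sq_left ha hb' hk0 hkm hkint hkrow hu,
    integrable_tensorKernel_mul_sq_right ha hb' hk0 hksymm hkm hkint hkrow hw⟩
  exact (hu.aestronglyMeasurable.comp_fst.mul hK₂m.aestronglyMeasurable).mul hw.aestronglyMeasurable.comp_snd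

/-- ★★ **STIFF block of the true kernel**: `T₂(Φ−PΦ, Φ−PΦ) ≤ (λ₀ρ + η·M)·μ₁·‖Φ−PΦ‖²`, `M = Π√(π/a_k)`. [cite: Luscher1983, §3] [cite: Helffer2013, Lemma 7.1] -/
theorem true_boOrth_le (ha : ∀ i, 0 < a i) (hb : ∀ i, 0 < b i) (hab : ∀ i, a i ^ 2 + 2 * a i * b i = π ^ 2)
    (hρ0 : 0 ≤ ρ) (hρ : ∀ i, b i / (a i + b i + π) ≤ ρ) (hρ1 : ρ ≤ 1) (hη : 0 ≤ η)
    (hk0 : ∀ c c', 0 ≤ k c c') (hksymm : ∀ c c', k c c' = k c' c) (hkm : Measurable (Function.uncurry k))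
    (hkint : ∀ c, Integrable (k c) ν) (hμ₁ : 0 ≤ μ₁) (hkrow : ∀ c, ∫ c', k c c' ∂ν ≤ μ₁)
    (hK₂m : Measurable (Function.uncurry K₂)) (hnear : ∀ x x', |K₂ x x' - 1 * tensorKernel k a b x x'| ≤ η * 1 * tensorKernel k a b x x')
    {Φ : C × (σ → ℝ) → ℝ} (hΦ : MemLp Φ 2 (ν.prod volume)) :
    ∫ x, ∫ x', boOrth Φ x * K₂ x x' * boOrth Φ x' ∂(ν.prod volume) ∂(ν.prod volume) ≤
      ((∏ i, Real.sqrt (π / (a i + b i + π))) * ρ + η * ∏ i, Real.sqrt (π / a i)) * μ₁ * ∫ x, boOrth Φ x ^ 2 ∂(ν.prod volume) := by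
  have hO := memLp_boOrth hΦ
  obtain ⟨h0, hsy, hrow, hu2, -, hmeas, hIabs, hI, hI1, hI2⟩ := tensor_comparison_data ha hb hk0 hksymm hkm hkint hkrow hK₂m hO hO
  have hM : 0 ≤ μ₁ * ∏ i, Real.sqrt (π / a i) := mul_nonneg hμ₁ (Finset.prod_nonneg fun i _ => Real.sqrt_nonneg _)
  have h1 := form_le_of_kernel_near (μ := ν.prod volume) zero_le_one hη h0 hsy hrow hnear hu2 hmeas hIabs hI hI1 hI2
  have h2 := tensorForm_boOrth_le ha hb hab hρ0 hρ hρ1 hk0 hksymm hkm hkint hμ₁ hkrow hΦ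
  rw [tensorForm_eq] at h2
  rw [one_mul] at h1
  have : (∫ x, ∫ x', boOrth Φ x * tensorKernel k a b x x' * boOrth Φ x' ∂(ν.prod volume) ∂(ν.prod volume)) +
      η * (μ₁ * ∏ i, Real.sqrt (π / a i)) * ∫ x, boOrth Φ x ^ 2 ∂(ν.prod volume) ≤
      ((∏ i, Real.sqrt (π / (a i + b i + π))) * ρ + η * ∏ i, Real.sqrt (π / a i)) * μ₁ * ∫ x, boOrth Φ x ^ 2 ∂(ν.prod volume) := by
    nlinarith [h2]
  exact h1.trans this

/-- ★★ **OFF-DIAGONAL block of the true kernel**: `|T₂(PΦ, Ψ−PΨ)| ≤ η·μ₁M·‖PΦ‖₂·‖Ψ−PΨ‖₂`. [cite: Luscher1983, §3] [cite: Helffer2013, Lemma 7.1] -/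
theorem true_boProj_boOrth (ha : ∀ i, 0 < a i) (hb : ∀ i, 0 < b i) (hab : ∀ i, a i ^ 2 + 2 * a i * b i = π ^ 2) (hη : 0 ≤ η)
    (hk0 : ∀ c c', 0 ≤ k c c') (hksymm : ∀ c c', k c c' = k c' c) (hkm : Measurable (Function.uncurry k))
    (hkint : ∀ c, Integrable (k c) ν) (hμ₁ : 0 ≤ μ₁) (hkrow : ∀ c, ∫ c', k c c' ∂ν ≤ μ₁)
    (hK₂m : Measurable (Function.uncurry K₂)) (hnear : ∀ x x', |K₂ x x' - 1 * tensorKernel k a b x x'| ≤ η * 1 * tensorKernel k a b x x')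
    {Φ Ψ : C × (σ → ℝ) → ℝ} (hΦ : MemLp Φ 2 (ν.prod volume)) (hΨ : MemLp Ψ 2 (ν.prod volume)) :
    |∫ x, ∫ x', boProj Φ x * K₂ x x' * boOrth Ψ x' ∂(ν.prod volume) ∂(ν.prod volume)| ≤
      η * (μ₁ * ∏ i, Real.sqrt (π / a i)) * (Real.sqrt (∫ x, boProj Φ x ^ 2 ∂(ν.prod volume)) * Real.sqrt (∫ x, boOrth Ψ x ^ 2 ∂(ν.prod volume))) := by
  have hP := memLp_boProj hΦ
  have hO := memLp_boOrth hΨ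
  obtain ⟨h0, hsy, hrow, hu2, hw2, hmeas, hIabs, hI, hI1, hI2⟩ := tensor_comparison_data ha hb hk0 hksymm hkm hkint hkrow hK₂m hP hO
  have hM : 0 ≤ μ₁ * ∏ i, Real.sqrt (π / a i) := mul_nonneg hμ₁ (Finset.prod_nonneg fun i _ => Real.sqrt_nonneg _)
  have h1 := abs_bilin_sub_le_of_kernel_near (μ := ν.prod volume) zero_le_one hη hM h0 hsy hrow hnear hu2 hw2 hmeas hIabs hI hI1 hI2
  have h2 := tensorForm_boProj_boOrth ha hb hab hk0 hksymm hkm hkint hμ₁ hkrow hΦ hΨ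
  rw [tensorForm_eq] at h2
  rw [h2, mul_zero, sub_zero, mul_one] at h1
  exact h1

/-- ★★ **DIAGONAL block of the true kernel**: `|T₂(PΦ, PΦ) − λ₀ ∫∫ φ₀ k φ₀| ≤ η·μ₁M·‖PΦ‖²`. [cite: Luscher1983, §3] [cite: Helffer2013, Lemma 7.1] -/
theorem true_boProj_boProj (ha : ∀ i, 0 < a i) (hb : ∀ i, 0 < b i) (hab : ∀ i, a i ^ 2 + 2 * a i * b i = π ^ 2) (hη : 0 ≤ η)
    (hk0 : ∀ c c', 0 ≤ k c c') (hksymm : ∀ c c', k c c' = k c' c) (hkm : Measurable (Function.uncurry k))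
    (hkint : ∀ c, Integrable (k c) ν) (hμ₁ : 0 ≤ μ₁) (hkrow : ∀ c, ∫ c', k c c' ∂ν ≤ μ₁)
    (hK₂m : Measurable (Function.uncurry K₂)) (hnear : ∀ x x', |K₂ x x' - 1 * tensorKernel k a b x x'| ≤ η * 1 * tensorKernel k a b x x')
    {Φ : C × (σ → ℝ) → ℝ} (hΦ : MemLp Φ 2 (ν.prod volume)) :
    |(∫ x, ∫ x', boProj Φ x * K₂ x x' * boProj Φ x' ∂(ν.prod volume) ∂(ν.prod volume)) -
        (∏ i, Real.sqrt (π / (a i + b i + π))) * ∫ c, ∫ c', slowCoeff Φ c * k c c' * slowCoeff Φ c' ∂ν ∂ν| ≤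
      η * (μ₁ * ∏ i, Real.sqrt (π / a i)) * ∫ x, boProj Φ x ^ 2 ∂(ν.prod volume) := by
  have hP := memLp_boProj hΦ
  obtain ⟨h0, hsy, hrow, hu2, -, hmeas, hIabs, hI, hI1, hI2⟩ := tensor_comparison_data ha hb hk0 hksymm hkm hkint hkrow hK₂m hP hP
  have h1 := abs_form_sub_le_of_kernel_near (μ := ν.prod volume) zero_le_one hη h0 hsy hrow hnear hu2 hmeas hIabs hI hI1 hI2
  have h2 := tensorForm_boProj_boProj ha hb hab hk0 hksymm hkm hkint hμ₁ hkrow hΦ hΦ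
  rw [tensorForm_eq] at h2
  rw [h2, one_mul, mul_one] at h1
  exact h1

end

end Summit.QuantumFields.YangMills.Theorems.FemtoTransferGap.Mehler
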